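import Summits.AtomisticToContinuum.HydrodynamicLimit.Theorems.AntiMazurCoboundariesCellForecastPressureDecayContactStatisticsGhost
import Summits.AtomisticToContinuum.HydrodynamicLimit.Theorems.AntiMazurCoboundariesCellForecastPressureDecayContactStatisticsAveraging
import Summits.AtomisticToContinuum.HydrodynamicLimit.Theorems.AntiMazurCoboundariesCellForecastPressureDecayKinematicAssemblyPairExchange
import HarnessLib

/-!
# S2c(F) · reduction of the near-contact pair statistics to the weak isotropy of the pair law
# (piece of stub `stub_contactStatistics`, crux line `enskog-compensator-martingale`,
# crux `CellForecastPressureDecay`, stmt-AtomisticToContinuum-13915)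

`ContactStatistics σ` asks that on thin contact shells `σ ≤ ‖q‖ ≤ σ + r` the pair law of the cell be ONE constant
times Lebesgue measure up to `C (r L² + r² L³)`. By the ghost-sphere representation (`…Ghost`) the pair law has
density `(Z_{m+1}/Z_{m+2}) F(q)`, `F(q)` = probability that a ghost at relative position `q` fits. This file proves:
* § 1 two excluded balls at centres `a, b` differ by a lens of volume `≤ 16 σ² ‖a − b‖`;* § 2 **the ghost moves continuously** (`abs_ghostFit_sub_le`): for `σ ≤ ‖q‖, ‖q'‖ ≤ R`,
  `|F(q) − F(q')| ≤ C_b R / L + 128 σ² ‖q − q'‖` — the fitting event changes only if the host is within `R` of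
  the boundary (`ContactLayerBounds` (c)) or some centre lies in the lens (Ruelle bound `posLaw_le_two_pow_mul_pi`);
* § 3 the registered sub-goal `stub_contactStatistics_reduction`: `ContactLayerBounds σ` and the weak isotropy of
  the pair law (the cluster-expansion input, companion files) imply `ContactStatistics σ`, with
  `c₂ = n(n−1) (Z_{n−1}/Z_n) F(σ e₀)` — § 2 and the weak isotropy make `F` nearly constant on the contact shell by
  the averaging lemma of the companion file `…Averaging`.

References: D. Ruelle, *Statistical Mechanics: Rigorous Results* (1969), §4.2; Hansen–McDonald (2013), §2.5.
-/

noncomputable section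

open MeasureTheory ProbabilityTheory Set Filter Metric
open scoped ENNReal BigOperators InnerProductSpace
open Literature.Analysis.FluidPDE Literature.MathematicalPhysics.KineticTheory
open Literature.MathematicalPhysics.StatisticalMechanics
open Summit.AtomisticToContinuum.HydrodynamicLimit.Theorems.CellForecastPressureDecay
  (cellCube measurableSet_cellCube volume_cellCube abs_apply_sub_apply_le canonicalPartition_cell_pos)

namespace Summit.AtomisticToContinuum.HydrodynamicLimit.Theorems.EnskogCompensator

/-! ## § 1 Two excluded balls differ by a thin lens -/
/-- **Two excluded balls differ by a thin lens**: `vol(B(a,σ) ∖ B(b,σ)) ≤ 16 σ² ‖a − b‖` (for `‖a − b‖ < σ` the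
difference lies in the spherical shell `B(a,σ) ∖ B(a, σ − ‖a−b‖)`). [folklore] -/
theorem volume_ball_diff_ball_le {σ : ℝ} (hσ : 0 < σ) (a b : V3) :
    volume (ball a σ \ ball b σ) ≤ ENNReal.ofReal (16 * σ ^ 2 * ‖a - b‖) := by
  set d : ℝ := ‖a - b‖ with hd_def
  have hd0 : 0 ≤ d := norm_nonneg _
  have hπ : Real.pi * 4 / 3 ≤ 16 / 3 := by linarith [Real.pi_le_four]
  have hball : ∀ r : ℝ, 0 ≤ r → volume (ball a r) = ENNReal.ofReal (r ^ 3 * (Real.pi * 4 / 3)) := fun r hr =>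
    by rw [EuclideanSpace.volume_ball_fin_three, ← ENNReal.ofReal_pow hr, ← ENNReal.ofReal_mul (by positivity)]
  by_cases hd : σ ≤ d
  · calc volume (ball a σ \ ball b σ) ≤ volume (ball a σ) := measure_mono fun z hz => hz.1
      _ = ENNReal.ofReal (σ ^ 3 * (Real.pi * 4 / 3)) := hball σ hσ.le
      _ ≤ ENNReal.ofReal (16 * σ ^ 2 * d) := ENNReal.ofReal_le_ofReal (by
          have h1 : σ ^ 3 ≤ σ ^ 2 * d := by rw [pow_succ]; exact mul_le_mul_of_nonneg_left hd (sq_nonneg σ)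
          calc σ ^ 3 * (Real.pi * 4 / 3) ≤ (σ ^ 2 * d) * (16 / 3) :=
                mul_le_mul h1 hπ (by positivity) (by positivity)
            _ ≤ 16 * σ ^ 2 * d := by nlinarith [mul_nonneg (sq_nonneg σ) hd0])
  · push Not at hd
    have hsub : ball a σ \ ball b σ ⊆ ball a σ \ ball a (σ - d) := by
      intro z hz
      refine ⟨hz.1, fun hz' => hz.2 ?_⟩
      rw [mem_ball] at hz' ⊢
      calc dist z b ≤ dist z a + dist a b := dist_triangle _ _ _
        _ < (σ - d) + d := by rw [dist_eq_norm a b]; linarith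
        _ = σ := by ring
    have hcube : σ ^ 3 - (σ - d) ^ 3 ≤ 3 * σ ^ 2 * d := by nlinarith [mul_nonneg (sq_nonneg d) (by linarith : 0 ≤ 3 * σ - d)]
    calc volume (ball a σ \ ball b σ) ≤ volume (ball a σ \ ball a (σ - d)) := measure_mono hsub
      _ = volume (ball a σ) - volume (ball a (σ - d)) :=
          measure_sdiff (ball_subset_ball (by linarith)) measurableSet_ball.nullMeasurableSet measure_ball_lt_top.ne
      _ = ENNReal.ofReal (σ ^ 3 * (Real.pi * 4 / 3) - (σ - d) ^ 3 * (Real.pi * 4 / 3)) := by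
          rw [hball σ hσ.le, hball (σ - d) (by linarith), ENNReal.ofReal_sub _ (by positivity)]
      _ ≤ ENNReal.ofReal (16 * σ ^ 2 * d) := ENNReal.ofReal_le_ofReal (by
          calc σ ^ 3 * (Real.pi * 4 / 3) - (σ - d) ^ 3 * (Real.pi * 4 / 3)
              = (σ ^ 3 - (σ - d) ^ 3) * (Real.pi * 4 / 3) := by ring
            _ ≤ (3 * σ ^ 2 * d) * (16 / 3) := mul_le_mul hcube hπ (by positivity) (by positivity)
            _ = 16 * σ ^ 2 * d := by ring)

/-! ## § 2 The ghost moves continuously -/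
/-- Moving the ghost from `y₀ − q` to `y₀ − q'` (`σ ≤ ‖q'‖ ≤ R`) loses the fitting event only if the host is within
`R` of the boundary or some centre lies in the lens `B(−q',σ) ∖ B(−q,σ)` of relative positions. [folklore] -/
theorem ghostFit_diff_subset (σ L : ℝ) (m : ℕ) {R : ℝ} {q q' : V3} (hq' : σ ≤ ‖q'‖) (hq'R : ‖q'‖ ≤ R) :
    {y : Fin (m + 1) → V3 | Fin.cons (y 0 - q) y ∈ posAdmissible σ L (m + 2)} \
        {y | Fin.cons (y 0 - q') y ∈ posAdmissible σ L (m + 2)} ⊆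
      {y | ∃ k, y 0 k < R ∨ L - R < y 0 k} ∪
        ⋃ k : Fin m, {y | y k.succ - y 0 ∈ ball (-q') σ \ ball (-q) σ} := by
  rintro y ⟨hy, hy'⟩
  rw [Set.mem_setOf_eq, insertGhost_mem_posAdmissible_iff] at hy hy'
  obtain ⟨hadm, hcube, hdist⟩ := hy
  by_cases hc : ∀ c, (y 0 - q') c ∈ Set.Icc (0 : ℝ) L
  · have hk : ¬ ∀ k, σ ≤ ‖y k - (y 0 - q')‖ := fun h => hy' ⟨hadm, hc, h⟩
    push Not at hk
    obtain ⟨k, hk⟩ := hk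
    rcases Fin.eq_zero_or_eq_succ k with rfl | ⟨k, rfl⟩
    · rw [sub_sub_cancel] at hk; exact absurd hq' (not_le.2 hk)
    · refine Or.inr (Set.mem_iUnion.2 ⟨k, ?_, fun h => ?_⟩)
      · have h3 : y k.succ - y 0 + q' = y k.succ - (y 0 - q') := by abel
        rw [mem_ball, dist_eq_norm, sub_neg_eq_add, h3]
        exact hk
      · rw [mem_ball, dist_eq_norm, sub_neg_eq_add] at h
        have h2 := hdist k.succ
        rw [show y k.succ - (y 0 - q) = y k.succ - y 0 + q by abel] at h2
        exact absurd h2 (not_le.2 h)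
  · push Not at hc
    obtain ⟨c, hcc⟩ := hc
    refine Or.inl ⟨c, ?_⟩
    have h0 : y 0 c ∈ Set.Icc (0 : ℝ) L := (mem_posAdmissible.1 hadm).2 0 c
    have hqc : |q' c| ≤ R := by
      have := abs_apply_sub_apply_le q' 0 c
      simp only [PiLp.zero_apply, sub_zero] at this
      exact this.trans hq'R
    have hsub : (y 0 - q') c = y 0 c - q' c := rfl
    rw [hsub, Set.mem_Icc, not_and_or, not_le, not_le] at hcc
    rcases hcc with h | h
    · exact Or.inl (by linarith [le_abs_self (q' c), h0.1])
    · exact Or.inr (by linarith [neg_abs_le (q' c), h0.2])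

/-- One lens event is small: `posLaw{y_{k+1} − y₀ ∈ B(−q',σ) ∖ B(−q,σ)} ≤ 64 σ² ‖q − q'‖ / L³` (Ruelle bound for the
two labels, then the lens volume). [cite: Ruelle1969, §4.2] -/
theorem posLaw_lens_le {σ L : ℝ} (hσ : 0 < σ) (hσ' : σ ≤ 3 / 16) (hL : 1 ≤ L) {m : ℕ}
    (hm : ((m + 1 : ℕ) : ℝ) ≤ 2 * L ^ 3) (q q' : V3) (k : Fin m) :
    posLaw σ L (m + 1) {y | y k.succ - y 0 ∈ ball (-q') σ \ ball (-q) σ} ≤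
      ENNReal.ofReal (64 * σ ^ 2 * ‖q - q'‖ / L ^ 3) := by
  have hL0 : 0 < L := by linarith
  have hT : MeasurableSet (ball (-q') σ \ ball (-q) σ) := measurableSet_ball.diff measurableSet_ball
  have hE := measurableSet_pairEvent_cell (n := m + 1) k.succ 0 hT
  have hk0 : k.succ ≠ (0 : Fin (m + 1)) := Fin.succ_ne_zero k
  have hcard : ({k.succ, 0} : Finset (Fin (m + 1))).card = 2 := Finset.card_pair hk0
  calc posLaw σ L (m + 1) {y | y k.succ - y 0 ∈ ball (-q') σ \ ball (-q) σ}
      ≤ 2 ^ ({k.succ, 0} : Finset (Fin (m + 1))).card *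
          Measure.pi (fun _ : Fin (m + 1) => volume[|cellCube L]) {y | y k.succ - y 0 ∈ ball (-q') σ \ ball (-q) σ} :=
        posLaw_le_two_pow_mul_pi hσ hσ' hL hm {k.succ, 0} hE fun x y hxy => by
          simp only [Set.mem_setOf_eq, hxy k.succ (by simp), hxy 0 (by simp)]
    _ ≤ 2 ^ 2 * ((volume (cellCube L))⁻¹ * volume (ball (-q') σ \ ball (-q) σ)) := by
        rw [hcard]; exact mul_le_mul' le_rfl (pi_cube_pairEvent_le hL0 hk0 hT)
    _ ≤ 2 ^ 2 * (ENNReal.ofReal ((L ^ 3)⁻¹) * ENNReal.ofReal (16 * σ ^ 2 * ‖q - q'‖)) := by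
        rw [inv_volume_cellCube hL0]
        gcongr
        have h5 : ‖(-q') - (-q)‖ = ‖q - q'‖ := by rw [neg_sub_neg]
        exact h5 ▸ volume_ball_diff_ball_le hσ (-q') (-q)
    _ = ENNReal.ofReal (64 * σ ^ 2 * ‖q - q'‖ / L ^ 3) := by
        rw [← ENNReal.ofReal_mul (by positivity), show (2 : ℝ≥0∞) ^ 2 = ENNReal.ofReal 4 by norm_num,
          ← ENNReal.ofReal_mul (by norm_num)]
        congr 1; field_simp; ring

/-- **The ghost moves continuously** (one-sided): for `σ ≤ ‖q'‖ ≤ R`, `F(q) − F(q') ≤ C_b R / L + 128 σ² ‖q − q'‖`,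
granted the boundary-layer bound (c) of `ContactLayerBounds` with constant `C_b`. [cite: Ruelle1969, §4.2] -/
theorem ghostFit_sub_le {σ L : ℝ} (hσ : 0 < σ) (hσ' : σ ≤ 3 / 16) (hL : 1 ≤ L) {m : ℕ}
    (hm : ((m + 1 : ℕ) : ℝ) ≤ 2 * L ^ 3) (h0 : posZ σ L (m + 1) ≠ 0) {Cb R : ℝ} (hCb : 0 ≤ Cb) (hR : 0 ≤ R)
    (hbd : posLaw σ L (m + 1) {y | ∃ k, y 0 k < R ∨ L - R < y 0 k} ≤ ENNReal.ofReal (Cb * R / L))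
    {q q' : V3} (hq' : σ ≤ ‖q'‖) (hq'R : ‖q'‖ ≤ R) :
    (posLaw σ L (m + 1)).real {y | Fin.cons (y 0 - q) y ∈ posAdmissible σ L (m + 2)} -
        (posLaw σ L (m + 1)).real {y | Fin.cons (y 0 - q') y ∈ posAdmissible σ L (m + 2)} ≤
      Cb * R / L + 128 * σ ^ 2 * ‖q - q'‖ := by
  haveI := isProbabilityMeasure_posLaw h0
  set μ := posLaw σ L (m + 1) with hμ
  set S := {y : Fin (m + 1) → V3 | Fin.cons (y 0 - q) y ∈ posAdmissible σ L (m + 2)} with hS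
  set S' := {y : Fin (m + 1) → V3 | Fin.cons (y 0 - q') y ∈ posAdmissible σ L (m + 2)} with hS'
  have h1 : μ.real S ≤ μ.real S' + μ.real (S \ S') :=
    (measureReal_mono (fun y hy => by by_cases h : y ∈ S'; exacts [Or.inl h, Or.inr ⟨hy, h⟩])).trans
      (measureReal_union_le _ _)
  have h2 : μ.real (S \ S') ≤ μ.real {y | ∃ k, y 0 k < R ∨ L - R < y 0 k} +
      ∑ k : Fin m, μ.real {y | y k.succ - y 0 ∈ ball (-q') σ \ ball (-q) σ} :=
    (measureReal_mono (ghostFit_diff_subset σ L m hq' hq'R)).trans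
      ((measureReal_union_le _ _).trans (add_le_add le_rfl (measureReal_iUnion_fintype_le _)))
  have h3 : μ.real {y | ∃ k, y 0 k < R ∨ L - R < y 0 k} ≤ Cb * R / L :=
    ENNReal.toReal_le_of_le_ofReal (by positivity) hbd
  have h4 : ∀ k : Fin m, μ.real {y | y k.succ - y 0 ∈ ball (-q') σ \ ball (-q) σ} ≤
      64 * σ ^ 2 * ‖q - q'‖ / L ^ 3 := fun k =>
    ENNReal.toReal_le_of_le_ofReal (by positivity) (posLaw_lens_le hσ hσ' hL hm q q' k)
  have h5 : ∑ k : Fin m, μ.real {y | y k.succ - y 0 ∈ ball (-q') σ \ ball (-q) σ} ≤ 128 * σ ^ 2 * ‖q - q'‖ := by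
    refine (Finset.sum_le_sum fun k _ => h4 k).trans ?_
    rw [Finset.sum_const, Finset.card_univ, Fintype.card_fin, nsmul_eq_mul]
    have hmL : (m : ℝ) ≤ 2 * L ^ 3 := le_trans (by exact_mod_cast Nat.le_succ m) hm
    have hX : 0 ≤ σ ^ 2 * ‖q - q'‖ := by positivity
    calc (m : ℝ) * (64 * σ ^ 2 * ‖q - q'‖ / L ^ 3) ≤ 2 * L ^ 3 * (64 * σ ^ 2 * ‖q - q'‖ / L ^ 3) :=
          mul_le_mul_of_nonneg_right hmL (by positivity)
      _ = 128 * σ ^ 2 * ‖q - q'‖ := by field_simp; ring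
  linarith

/-- **The ghost moves continuously**: for `σ ≤ ‖q‖, ‖q'‖ ≤ R`, `|F(q) − F(q')| ≤ C_b R / L + 128 σ² ‖q − q'‖`.
[cite: Ruelle1969, §4.2] -/
theorem abs_ghostFit_sub_le {σ L : ℝ} (hσ : 0 < σ) (hσ' : σ ≤ 3 / 16) (hL : 1 ≤ L) {m : ℕ}
    (hm : ((m + 1 : ℕ) : ℝ) ≤ 2 * L ^ 3) (h0 : posZ σ L (m + 1) ≠ 0) {Cb R : ℝ} (hCb : 0 ≤ Cb) (hR : 0 ≤ R)
    (hbd : posLaw σ L (m + 1) {y | ∃ k, y 0 k < R ∨ L - R < y 0 k} ≤ ENNReal.ofReal (Cb * R / L))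
    {q q' : V3} (hq : σ ≤ ‖q‖) (hq' : σ ≤ ‖q'‖) (hqR : ‖q‖ ≤ R) (hq'R : ‖q'‖ ≤ R) :
    |(posLaw σ L (m + 1)).real {y | Fin.cons (y 0 - q) y ∈ posAdmissible σ L (m + 2)} -
        (posLaw σ L (m + 1)).real {y | Fin.cons (y 0 - q') y ∈ posAdmissible σ L (m + 2)}| ≤
      Cb * R / L + 128 * σ ^ 2 * ‖q - q'‖ := by
  rw [abs_sub_le_iff]
  refine ⟨ghostFit_sub_le hσ hσ' hL hm h0 hCb hR hbd hq' hq'R, ?_⟩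
  rw [norm_sub_rev]
  exact ghostFit_sub_le hσ hσ' hL hm h0 hCb hR hbd hq hqR

/-! ## § 3 Assembly: `ContactStatistics` from the contact-layer bounds and the weak isotropy -/
/-- In the regime of the line the positional partition function is positive. [folklore] -/
theorem posZ_ne_zero {σ L : ℝ} (hσ' : σ ≤ 3 / 16) (hL : 1 ≤ L) {n : ℕ} (hn : (n : ℝ) ≤ 2 * L ^ 3) :
    posZ σ L n ≠ 0 := by
  intro h0
  have h := canonicalPartition_cell_pos (σ := σ) hσ' hL hn
  rw [canonicalPartition_cell_eq_toReal_posZ, h0, ENNReal.toReal_zero] at h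
  exact lt_irrefl _ h

/-- A measurable function dominated by a constant on a set of finite measure and vanishing outside it is
integrable. [folklore] -/
theorem integrable_of_abs_le_indicator {f : V3 → ℝ} (hf : Measurable f) {S : Set V3} (hS : MeasurableSet S)
    (hSfin : volume S ≠ ⊤) {b : ℝ} (hb : ∀ q, |f q| ≤ S.indicator (fun _ => b) q) : Integrable f volume :=
  Integrable.mono' ((integrableOn_const hSfin (C := b)).integrable_indicator hS) hf.aestronglyMeasurable
    (Eventually.of_forall fun q => (Real.norm_eq_abs _).le.trans (hb q))

/-- **Registered sub-goal `stub_contactStatistics_reduction`** (piece of stub `stub_contactStatistics`, S2c, of the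
line `enskog-compensator-martingale`): the near-contact pair statistics `ContactStatistics σ` follow from the
contact-layer bounds `ContactLayerBounds σ` (S2b) and the WEAK ISOTROPY of the pair law of the cell — for `L ≥ L₁`,
`n ≤ 2L³`, `i ≠ j`, every linear isometry `g` of `ℝ³` and every measurable `|ψ| ≤ 1` supported in `‖q‖ ≤ σ + 3`,
`|E ψ(xᵢ − xⱼ) − E ψ(g(xᵢ − xⱼ))| ≤ (K/L⁴) ∫|ψ|` (the cluster-expansion input). Route: ghost-sphere representation of
the pair density, radial near-constancy by moving the ghost (Ruelle bound), angular near-constancy by averaging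
over rotated balls of radius `1/L`; `c₂ = n(n−1)(Z_{n−1}/Z_n) F(σ e₀)`. [cite: Ruelle1969, §4.2] -/
theorem stub_contactStatistics_reduction : ∀ σ : ℝ, 0 < σ → σ ≤ 3 / 16 → ContactLayerBounds σ →
    (∃ K : ℝ, 0 ≤ K ∧ ∃ L₁ : ℝ, 1 ≤ L₁ ∧ ∀ L : ℝ, L₁ ≤ L → ∀ n : ℕ, (n : ℝ) ≤ 2 * L ^ 3 →
      ∀ i j : Fin n, i ≠ j → ∀ g : V3 ≃ₗᵢ[ℝ] V3, ∀ ψ : V3 → ℝ, Measurable ψ → (∀ q, |ψ q| ≤ 1) →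
        (∀ q, ψ q ≠ 0 → ‖q‖ ≤ σ + 3) →
          |(∫ x, ψ (x i - x j) ∂(posLaw σ L n)) - ∫ x, ψ (g (x i - x j)) ∂(posLaw σ L n)| ≤
            K / L ^ 4 * ∫ q, |ψ q|) →
    ContactStatistics σ := by
  intro σ hσ hσ' hCLB hWI
  obtain ⟨Cb, hCb0, hCb⟩ := hCLB
  obtain ⟨K, hK0, L₁, hL₁, hW⟩ := hWI
  set A : ℝ := Cb * (σ + 3) with hA
  set B : ℝ := 128 * σ ^ 2 with hB
  set A₂ : ℝ := 3 * A + K + 4 * B with hA₂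
  have hA0 : 0 ≤ A := by positivity
  have hB0 : 0 ≤ B := by positivity
  have hA₂0 : 0 ≤ A₂ := by positivity
  refine ⟨128 * (A₂ + B), by positivity, L₁, hL₁, fun L hL n hn => ?_⟩
  have hL1 : 1 ≤ L := hL₁.trans hL
  have hL0 : 0 < L := by linarith
  have hRHS : ∀ r : ℝ, 0 ≤ r → 0 ≤ 128 * (A₂ + B) * (r * L ^ 2 + r ^ 2 * L ^ 3) := fun r hr => by positivity
  rcases Nat.lt_or_ge n 2 with hn2 | hn2
  · -- fewer than two spheres: no pair
    refine ⟨0, le_rfl, fun r hr _ φ _ _ _ => ?_⟩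
    have hsum : (∑ i : Fin n, ∑ j : Fin n,
        if i = j then (0 : ℝ) else ∫ x, φ (x i - x j) ∂(posLaw σ L n)) = 0 := by
      refine Finset.sum_eq_zero fun i _ => Finset.sum_eq_zero fun j _ => ?_
      have hij : i = j := Fin.ext (by omega)
      rw [if_pos hij]
    rw [hsum, zero_mul, sub_zero, abs_zero]
    exact hRHS r hr
  · obtain ⟨m, rfl⟩ : ∃ m, n = m + 2 := ⟨n - 2, by omega⟩
    have hm1 : ((m + 1 : ℕ) : ℝ) ≤ 2 * L ^ 3 := le_trans (by exact_mod_cast Nat.le_succ _) hn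
    have hZ1 : posZ σ L (m + 1) ≠ 0 := posZ_ne_zero hσ' hL1 hm1
    have hZ2 : posZ σ L (m + 2) ≠ 0 := posZ_ne_zero hσ' hL1 hn
    haveI := isProbabilityMeasure_posLaw hZ1
    haveI := isProbabilityMeasure_posLaw hZ2
    have h10 : (1 : Fin (m + 2)) ≠ 0 := Fin.zero_lt_one.ne'
    -- the fitting probability of the ghost and the density ratio
    set F : V3 → ℝ := fun q =>
      (posLaw σ L (m + 1)).real {y | Fin.cons (y 0 - q) y ∈ posAdmissible σ L (m + 2)} with hF
    set ρ₁ : ℝ := ((posZ σ L (m + 2))⁻¹ * posZ σ L (m + 1)).toReal with hρ₁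
    have hFm : Measurable F :=
      (measurable_measure_prodMk_left (ν := posLaw σ L (m + 1)) (measurableSet_insertGhost σ L m)).ennreal_toReal
    have hF0 : ∀ q, 0 ≤ F q := fun q => measureReal_nonneg
    have hF1 : ∀ q, F q ≤ 1 := fun q => (measureReal_mono (Set.subset_univ _)).trans_eq probReal_univ
    have hrep : ∀ ψ : V3 → ℝ, Measurable ψ →
        ∫ x, ψ (x 1 - x 0) ∂(posLaw σ L (m + 2)) = ρ₁ * ∫ q, ψ q * F q := fun ψ hψ =>
      integral_pairDiff_posLaw σ L m hZ1 hψ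
    -- the density ratio is between `L⁻³` and `2 L⁻³`
    have hz1 : 0 < (posZ σ L (m + 1)).toReal := ENNReal.toReal_pos hZ1 (posZ_lt_top σ L (m + 1)).ne
    have hz2 : 0 < (posZ σ L (m + 2)).toReal := ENNReal.toReal_pos hZ2 (posZ_lt_top σ L (m + 2)).ne
    have hρ₁eq : ρ₁ = (posZ σ L (m + 1)).toReal / (posZ σ L (m + 2)).toReal := by
      rw [hρ₁, ENNReal.toReal_mul, ENNReal.toReal_inv, div_eq_inv_mul]
    obtain ⟨hmass1, hmass2⟩ := posZ_succ_bounds σ L m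
    have hvb : volume (Metric.ball (0 : V3) σ) = ENNReal.ofReal (σ ^ 3 * (Real.pi * 4 / 3)) := by
      rw [EuclideanSpace.volume_ball_fin_three, ← ENNReal.ofReal_pow hσ.le, ← ENNReal.ofReal_mul (by positivity)]
    have hvQ : volume (cellCube L) = ENNReal.ofReal (L ^ 3) := by rw [volume_cellCube, ENNReal.ofReal_pow hL0.le]
    have hsmall : ((m + 1 : ℕ) : ℝ) * (σ ^ 3 * (Real.pi * 4 / 3)) ≤ L ^ 3 / 2 := by
      have hσ3 : σ ^ 3 ≤ (3 / 16) ^ 3 := pow_le_pow_left₀ hσ.le hσ' 3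
      have hπ : Real.pi * 4 / 3 ≤ 16 / 3 := by linarith [Real.pi_le_four]
      calc ((m + 1 : ℕ) : ℝ) * (σ ^ 3 * (Real.pi * 4 / 3)) ≤ (2 * L ^ 3) * ((3 / 16) ^ 3 * (16 / 3)) :=
            mul_le_mul hm1 (mul_le_mul hσ3 hπ (by positivity) (by positivity)) (by positivity) (by positivity)
        _ ≤ L ^ 3 / 2 := by nlinarith [pow_pos hL0 3]
    have hz2le : (posZ σ L (m + 2)).toReal ≤ (posZ σ L (m + 1)).toReal * L ^ 3 := by
      have := ENNReal.toReal_mono (ENNReal.mul_ne_top (posZ_lt_top σ L (m + 1)).ne ENNReal.ofReal_ne_top)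
        (hvQ ▸ hmass2)
      rwa [ENNReal.toReal_mul, ENNReal.toReal_ofReal (by positivity)] at this
    have hz2ge : (posZ σ L (m + 1)).toReal * (L ^ 3 / 2) ≤ (posZ σ L (m + 2)).toReal := by
      have hsub : ENNReal.ofReal (L ^ 3 / 2) ≤
          volume (cellCube L) - (m + 1 : ℕ) * volume (Metric.ball (0 : V3) σ) := by
        rw [hvQ, hvb, ← ENNReal.ofReal_natCast, ← ENNReal.ofReal_mul (Nat.cast_nonneg _),
          ← ENNReal.ofReal_sub _ (by positivity)]
        exact ENNReal.ofReal_le_ofReal (by linarith)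
      have h1 : posZ σ L (m + 1) * ENNReal.ofReal (L ^ 3 / 2) ≤ posZ σ L (m + 2) :=
        (mul_le_mul' le_rfl hsub).trans hmass1
      have := ENNReal.toReal_mono (posZ_lt_top σ L (m + 2)).ne h1
      rwa [ENNReal.toReal_mul, ENNReal.toReal_ofReal (by positivity)] at this
    have hρ₁le : ρ₁ ≤ 2 / L ^ 3 := by
      rw [hρ₁eq, div_le_div_iff₀ hz2 (by positivity)]
      nlinarith
    have hρ₁ge : 1 / L ^ 3 ≤ ρ₁ := by
      rw [hρ₁eq, div_le_div_iff₀ (by positivity) hz2]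
      nlinarith
    have hρ₁0 : 0 < ρ₁ := lt_of_lt_of_le (by positivity) hρ₁ge
    -- the ghost moves continuously
    have hlip : ∀ q q' : V3, σ ≤ ‖q‖ → σ ≤ ‖q'‖ → ‖q‖ ≤ σ + 3 → ‖q'‖ ≤ σ + 3 →
        |F q - F q'| ≤ A / L + B * ‖q - q'‖ := by
      intro q q' hq hq' hqR hq'R
      have hbd := (hCb L hL1 (m + 1) hm1).2.2 (σ + 3) (by linarith) 0
      have h := abs_ghostFit_sub_le hσ hσ' hL1 hm1 hZ1 hCb0 (by linarith : (0 : ℝ) ≤ σ + 3) hbd hq hq' hqR hq'R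
      rw [hA, mul_div_assoc] at *
      exact h
    -- the weak isotropy of the pair law is the weak isotropy of `F`
    have hiso : ∀ (g : V3 ≃ₗᵢ[ℝ] V3) (ψ : V3 → ℝ), Measurable ψ → (∀ q, |ψ q| ≤ 1) →
        (∀ q, ψ q ≠ 0 → ‖q‖ ≤ σ + 3) → |(∫ q, ψ q * F q) - ∫ q, ψ (g q) * F q| ≤ K / L * ∫ q, |ψ q| := by
      intro g ψ hψ hψ1 hψs
      have h := hW L hL (m + 2) hn 1 0 h10 g ψ hψ hψ1 hψs
      rw [hrep ψ hψ, hrep (fun q => ψ (g q)) (hψ.comp g.continuous.measurable), ← mul_sub, abs_mul,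
        abs_of_pos hρ₁0] at h
      have hint0 : 0 ≤ ∫ q, |ψ q| := integral_nonneg fun q => abs_nonneg _
      calc |(∫ q, ψ q * F q) - ∫ q, ψ (g q) * F q| ≤ (K / L ^ 4 * ∫ q, |ψ q|) / ρ₁ := by
            rw [le_div_iff₀ hρ₁0, mul_comm]; exact h
        _ ≤ (K / L ^ 4 * ∫ q, |ψ q|) / (1 / L ^ 3) := div_le_div_of_nonneg_left (by positivity) (by positivity) hρ₁ge
        _ = K / L * ∫ q, |ψ q| := by field_simp
    -- pointwise near-constancy on the unit shell
    clear_value F ρ₁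
    obtain ⟨e₀, he₀⟩ : ∃ e : V3, ‖e‖ = 1 := exists_norm_eq V3 zero_le_one
    have hnc : ∀ q : V3, σ ≤ ‖q‖ → ‖q‖ ≤ σ + 1 → |F q - F (σ • e₀)| ≤ A₂ / L + B * (‖q‖ - σ) :=
      fun q hq hq1 => ghost_near_const hFm hF0 hF1 hσ hL1 hB0 hlip hiso he₀ hq hq1
    -- the constant and the estimate
    have hn1 : (0 : ℝ) ≤ ((m + 2 : ℕ) : ℝ) - 1 := by push_cast; linarith
    refine ⟨((m + 2 : ℕ) : ℝ) * (((m + 2 : ℕ) : ℝ) - 1) * ρ₁ * F (σ • e₀),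
      mul_nonneg (mul_nonneg (mul_nonneg (Nat.cast_nonneg _) hn1) hρ₁0.le) (hF0 _), fun r hr hr1 φ hφm hφ1 hφs => ?_⟩
    rw [sum_integral_posLaw_pair σ L φ h10, hrep φ hφm]
    set S : Set V3 := Metric.closedBall (0 : V3) (σ + r) \ Metric.ball 0 σ with hSdef
    have hSm : MeasurableSet S := measurableSet_closedBall.diff measurableSet_ball
    have hSvol : volume S ≤ ENNReal.ofReal (8 * (r + r ^ 3)) := volume_shell_le hσ hσ' hr
    have hSfin : volume S ≠ ⊤ := (hSvol.trans_lt ENNReal.ofReal_lt_top).ne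
    have hSreal : volume.real S ≤ 16 * r := by
      refine (ENNReal.toReal_le_of_le_ofReal (by positivity) hSvol).trans ?_
      have h3 : r ^ 3 ≤ r := by
        have := pow_le_one₀ (n := 2) hr hr1
        nlinarith
      linarith
    have hφS : ∀ q, φ q ≠ 0 → q ∈ S := fun q hq => by
      obtain ⟨h1, h2⟩ := hφs q hq
      exact ⟨Metric.mem_closedBall.2 (by rwa [dist_zero_right]), fun h => not_lt.2 h1 (by rwa [Metric.mem_ball, dist_zero_right] at h)⟩
    have hφind : ∀ (c : ℝ), |c| ≤ 1 → ∀ q, |c * φ q| ≤ S.indicator (fun _ => (1 : ℝ)) q := by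
      intro c hc q
      by_cases hq : φ q = 0
      · rw [hq, mul_zero, abs_zero]; exact Set.indicator_nonneg (fun _ _ => zero_le_one) q
      · rw [Set.indicator_of_mem (hφS q hq), abs_mul]
        exact mul_le_one₀ hc (abs_nonneg _) (hφ1 q)
    have hint1 : Integrable (fun q => φ q * F q) volume :=
      integrable_of_abs_le_indicator (hφm.mul hFm) hSm hSfin fun q => by
        rw [mul_comm]; exact hφind (F q) (by rw [abs_of_nonneg (hF0 q)]; exact hF1 q) q
    have hint2 : Integrable (fun q => F (σ • e₀) * φ q) volume :=
      integrable_of_abs_le_indicator (hφm.const_mul _) hSm hSfin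
        (hφind (F (σ • e₀)) (by rw [abs_of_nonneg (hF0 _)]; exact hF1 _))
    have hkey : |(∫ q, φ q * F q) - F (σ • e₀) * ∫ q, φ q| ≤ (A₂ / L + B * r) * (16 * r) := by
      rw [← integral_const_mul, ← integral_sub hint1 hint2]
      calc |∫ q, (φ q * F q - F (σ • e₀) * φ q)| ≤ ∫ q, |φ q * F q - F (σ • e₀) * φ q| :=
            abs_integral_le_integral_abs
        _ ≤ ∫ q, S.indicator (fun _ => A₂ / L + B * r) q := by
            refine integral_mono (hint1.sub hint2).abs ((integrableOn_const hSfin).integrable_indicator hSm)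
              fun q => ?_
            by_cases hq : φ q = 0
            · simp only [hq, zero_mul, mul_zero, sub_zero, abs_zero]
              exact Set.indicator_nonneg (fun _ _ => by positivity) q
            · have hqS := hφS q hq
              rw [Set.indicator_of_mem hqS, show φ q * F q - F (σ • e₀) * φ q = φ q * (F q - F (σ • e₀)) by ring,
                abs_mul]
              have h1 : σ ≤ ‖q‖ := (hφs q hq).1
              have h2 : ‖q‖ ≤ σ + r := (hφs q hq).2
              calc |φ q| * |F q - F (σ • e₀)| ≤ 1 * (A₂ / L + B * (‖q‖ - σ)) :=
                    mul_le_mul (hφ1 q) (hnc q h1 (by linarith)) (abs_nonneg _) zero_le_one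
                _ ≤ A₂ / L + B * r := by nlinarith
        _ = (A₂ / L + B * r) * volume.real S := by rw [integral_indicator_const _ hSm, smul_eq_mul, mul_comm]
        _ ≤ (A₂ / L + B * r) * (16 * r) := mul_le_mul_of_nonneg_left hSreal (by positivity)
    -- `n (n − 1) ρ₁ ≤ 8 L³`
    have hpref : ((m + 2 : ℕ) : ℝ) * (((m + 2 : ℕ) : ℝ) - 1) * ρ₁ ≤ 8 * L ^ 3 := by
      have h1 : ((m + 2 : ℕ) : ℝ) - 1 ≤ 2 * L ^ 3 := by linarith
      calc ((m + 2 : ℕ) : ℝ) * (((m + 2 : ℕ) : ℝ) - 1) * ρ₁ ≤ (2 * L ^ 3) * (2 * L ^ 3) * (2 / L ^ 3) :=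
            mul_le_mul (mul_le_mul hn h1 hn1 (by positivity)) hρ₁le hρ₁0.le (by positivity)
        _ = 8 * L ^ 3 := by field_simp; ring
    have hP0 : 0 ≤ ((m + 2 : ℕ) : ℝ) * (((m + 2 : ℕ) : ℝ) - 1) * ρ₁ :=
      mul_nonneg (mul_nonneg (Nat.cast_nonneg _) hn1) hρ₁0.le
    have hfinal : |((m + 2 : ℕ) : ℝ) * (((m + 2 : ℕ) : ℝ) - 1) * (ρ₁ * ∫ q, φ q * F q) -
        ((m + 2 : ℕ) : ℝ) * (((m + 2 : ℕ) : ℝ) - 1) * ρ₁ * F (σ • e₀) * ∫ q, φ q| =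
          ((m + 2 : ℕ) : ℝ) * (((m + 2 : ℕ) : ℝ) - 1) * ρ₁ * |(∫ q, φ q * F q) - F (σ • e₀) * ∫ q, φ q| := by
      rw [show ((m + 2 : ℕ) : ℝ) * (((m + 2 : ℕ) : ℝ) - 1) * (ρ₁ * ∫ q, φ q * F q) -
          ((m + 2 : ℕ) : ℝ) * (((m + 2 : ℕ) : ℝ) - 1) * ρ₁ * F (σ • e₀) * ∫ q, φ q =
            (((m + 2 : ℕ) : ℝ) * (((m + 2 : ℕ) : ℝ) - 1) * ρ₁) * ((∫ q, φ q * F q) - F (σ • e₀) * ∫ q, φ q) by ring,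
        abs_mul, abs_of_nonneg hP0]
    rw [hfinal]
    calc ((m + 2 : ℕ) : ℝ) * (((m + 2 : ℕ) : ℝ) - 1) * ρ₁ * |(∫ q, φ q * F q) - F (σ • e₀) * ∫ q, φ q|
        ≤ (8 * L ^ 3) * ((A₂ / L + B * r) * (16 * r)) :=
          mul_le_mul hpref hkey (abs_nonneg _) (by positivity)
      _ = 128 * (A₂ * (r * (L ^ 3 / L)) + B * (r ^ 2 * L ^ 3)) := by ring
      _ = 128 * (A₂ * (r * L ^ 2) + B * (r ^ 2 * L ^ 3)) := by
          rw [show L ^ 3 / L = L ^ 2 by rw [pow_succ, mul_div_assoc, div_self hL0.ne', mul_one]]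
      _ ≤ 128 * (A₂ * (r * L ^ 2) + B * (r ^ 2 * L ^ 3)) + 128 * (A₂ * (r ^ 2 * L ^ 3) + B * (r * L ^ 2)) :=
          le_add_of_nonneg_right (by positivity)
      _ = 128 * (A₂ + B) * (r * L ^ 2 + r ^ 2 * L ^ 3) := by ring

end Summit.AtomisticToContinuum.HydrodynamicLimit.Theorems.EnskogCompensator
end
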